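import Mathlib
import HarnessLib
import Summits.HubbardSuperconductivity.HubbardSuperconductivity.Theorems.KLProgrammeThinLevelSetCubePacking

/-!
# Route `KLProgramme` — K3 engine (stmt-HubbardSuperconductivity-20437), stub (b) (ℓ)/(I2)–(I3), located item «ABS-UMK-COUNT» / «UV-REMEASURE-COUNT»:
# lattice points in thin level sets, part 3 — the RADIAL GROWTH hypotheses of `volume_levelWindow_le` from second-derivative bounds along segments

Cell gate-hubbard-kl, seat p4 g14 (pen (R133)(ii)).  `…ThinLevelSetVolume.volume_levelWindow_le` / `card_mul_pow_le_of_levelWindow` take as hypotheses, for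
the function `F` and the point `x⋆`, (growth) `F(homothety x⋆ t x) ≤ F x − (c/2)(1 − t²)‖x − x⋆‖²` for `t ∈ [0,1]` and (upper) `F x − F x⋆ ≤ (A/2)‖x − x⋆‖²`.
Along the segment `s ↦ g(s) := F(homothety x⋆ s x)` these are ONE-VARIABLE facts: if `g′(0) ≥ 0` and `g″ ≥ κ` on `[0,1]` then
`g 1 − g t ≥ (κ/2)(1 − t²)`; if `g′(0) = 0` and `g″ ≤ K` on `[0,1]` then `g 1 − g 0 ≤ K/2` (take `κ = c‖x − x⋆‖²`, `K = A‖x − x⋆‖²` from a Hessian floor /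
ceiling of `F`).  This file proves them (monotonicity of `g′(s) − κs` and of `g(s) − κs²/2`):

* `deriv_ge_mul_of_deriv2_ge`, `sub_ge_of_deriv2_ge` — the lower (strong growth) bounds;
* `deriv_le_mul_of_deriv2_le`, `sub_le_of_deriv2_le` — the upper bounds;
* `radialGrowth_of_segment`, `radialUpper_of_segment` — the same in the `homothety` form consumed by `volume_levelWindow_le`.

Everything is PROVED; no definitions, no named facts; generic one-variable calculus. [folklore]
-/

noncomputable section

open Real Set

namespace Summit.HubbardSuperconductivity.HubbardSuperconductivity.Theorems.ThinLevelSet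

set_option linter.dupNamespace false -- summit = problem name (single-conjunct summit), D-0017

/-! ## §1 One-variable growth from a second-derivative floor / ceiling -/

/-- If `g′(0) ≥ 0` and `g″ ≥ κ` on `[0, 1]`, then `g′ s ≥ κ s` on `[0, 1]` (the function `g′(s) − κ s` is monotone). [folklore] -/
theorem deriv_ge_mul_of_deriv2_ge {g' g'' : ℝ → ℝ} (hg' : ∀ s, HasDerivAt g' (g'' s) s) {κ : ℝ}
    (hκ : ∀ s ∈ Icc (0 : ℝ) 1, κ ≤ g'' s) (h0 : 0 ≤ g' 0) {s : ℝ} (hs : s ∈ Icc (0 : ℝ) 1) : κ * s ≤ g' s := by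
  have hmono : MonotoneOn (fun u => g' u - κ * u) (Icc (0 : ℝ) 1) := by
    apply monotoneOn_of_deriv_nonneg (convex_Icc 0 1)
    · exact (HasDerivAt.continuousOn fun u _ => (hg' u).sub ((hasDerivAt_id u).const_mul κ))
    · intro u _
      exact ((hg' u).sub ((hasDerivAt_id u).const_mul κ)).differentiableAt.differentiableWithinAt
    · intro u hu
      rw [interior_Icc] at hu
      have hd : HasDerivAt (fun u => g' u - κ * u) (g'' u - κ * 1) u := (hg' u).sub ((hasDerivAt_id u).const_mul κ)
      rw [hd.deriv]
      have := hκ u (Ioo_subset_Icc_self hu)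
      linarith
  have h := hmono (left_mem_Icc.2 zero_le_one) hs hs.1
  simp only [mul_zero, sub_zero] at h
  linarith

/-- If `g′(0) ≥ 0` and `g″ ≥ κ` on `[0, 1]`, then `g 1 − g t ≥ (κ/2)(1 − t²)` for `t ∈ [0, 1]` (the function `g(s) − κ s²/2` is monotone). [folklore] -/
theorem sub_ge_of_deriv2_ge {g g' g'' : ℝ → ℝ} (hg : ∀ s, HasDerivAt g (g' s) s) (hg' : ∀ s, HasDerivAt g' (g'' s) s) {κ : ℝ}
    (hκ : ∀ s ∈ Icc (0 : ℝ) 1, κ ≤ g'' s) (h0 : 0 ≤ g' 0) {t : ℝ} (ht : t ∈ Icc (0 : ℝ) 1) :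
    κ / 2 * (1 - t ^ 2) ≤ g 1 - g t := by
  have hmono : MonotoneOn (fun u => g u - κ / 2 * u ^ 2) (Icc (0 : ℝ) 1) := by
    have hd : ∀ u, HasDerivAt (fun u => g u - κ / 2 * u ^ 2) (g' u - κ / 2 * (2 * u)) u := by
      intro u
      have h1 : HasDerivAt (fun u : ℝ => u ^ 2) (2 * u) u := by
        simpa using hasDerivAt_pow 2 u
      exact (hg u).sub (h1.const_mul (κ / 2))
    apply monotoneOn_of_deriv_nonneg (convex_Icc 0 1)
    · exact HasDerivAt.continuousOn fun u _ => hd u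
    · intro u _; exact (hd u).differentiableAt.differentiableWithinAt
    · intro u hu
      rw [interior_Icc] at hu
      rw [(hd u).deriv]
      have := deriv_ge_mul_of_deriv2_ge hg' hκ h0 (Ioo_subset_Icc_self hu)
      linarith
  have h := hmono ht (right_mem_Icc.2 zero_le_one) ht.2
  simp only [one_pow, mul_one] at h
  linarith

/-- If `g′(0) ≤ 0` and `g″ ≤ K` on `[0, 1]`, then `g′ s ≤ K s` on `[0, 1]`. [folklore] -/
theorem deriv_le_mul_of_deriv2_le {g' g'' : ℝ → ℝ} (hg' : ∀ s, HasDerivAt g' (g'' s) s) {K : ℝ}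
    (hK : ∀ s ∈ Icc (0 : ℝ) 1, g'' s ≤ K) (h0 : g' 0 ≤ 0) {s : ℝ} (hs : s ∈ Icc (0 : ℝ) 1) : g' s ≤ K * s := by
  have h := deriv_ge_mul_of_deriv2_ge (g' := fun u => -g' u) (g'' := fun u => -g'' u) (κ := -K) (fun u => (hg' u).neg)
    (fun u hu => by linarith [hK u hu]) (by linarith) hs
  linarith

/-- If `g′(0) ≤ 0` and `g″ ≤ K` on `[0, 1]`, then `g 1 − g t ≤ (K/2)(1 − t²)` for `t ∈ [0, 1]`; in particular `g 1 − g 0 ≤ K/2`. [folklore] -/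
theorem sub_le_of_deriv2_le {g g' g'' : ℝ → ℝ} (hg : ∀ s, HasDerivAt g (g' s) s) (hg' : ∀ s, HasDerivAt g' (g'' s) s) {K : ℝ}
    (hK : ∀ s ∈ Icc (0 : ℝ) 1, g'' s ≤ K) (h0 : g' 0 ≤ 0) {t : ℝ} (ht : t ∈ Icc (0 : ℝ) 1) :
    g 1 - g t ≤ K / 2 * (1 - t ^ 2) := by
  have h := sub_ge_of_deriv2_ge (g := fun u => -g u) (g' := fun u => -g' u) (g'' := fun u => -g'' u) (κ := -K)
    (fun u => (hg u).neg) (fun u => (hg' u).neg) (fun u hu => by linarith [hK u hu]) (by linarith) ht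
  linarith

/-! ## §2 In the `homothety` form consumed by `volume_levelWindow_le` -/

/-- **Radial strong growth from a second-derivative floor along the segment.**  If along `s ↦ g(s) := F(homothety x⋆ s x)` one has derivatives `g′, g″`
with `g′(0) ≥ 0` (e.g. `x⋆` minimises `F` on a convex set containing `x`) and `g″ ≥ c‖x − x⋆‖²` on `[0,1]` (a Hessian floor of `F`), then for `t ∈ [0,1]`:
`F(homothety x⋆ t x) ≤ F x − (c/2)(1 − t²)‖x − x⋆‖²`. [folklore] -/
theorem radialGrowth_of_segment {E : Type*} [NormedAddCommGroup E] [NormedSpace ℝ E] {F : E → ℝ} {xs x : E} {g' g'' : ℝ → ℝ} {c : ℝ}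
    (hg : ∀ s, HasDerivAt (fun s : ℝ => F (AffineMap.homothety xs s x)) (g' s) s) (hg' : ∀ s, HasDerivAt g' (g'' s) s)
    (h0 : 0 ≤ g' 0) (hfloor : ∀ s ∈ Icc (0 : ℝ) 1, c * ‖x - xs‖ ^ 2 ≤ g'' s) {t : ℝ} (ht0 : 0 ≤ t) (ht1 : t ≤ 1) :
    F (AffineMap.homothety xs t x) ≤ F x - c / 2 * (1 - t ^ 2) * ‖x - xs‖ ^ 2 := by
  have h := sub_ge_of_deriv2_ge hg hg' hfloor h0 ⟨ht0, ht1⟩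
  have e : AffineMap.homothety xs (1 : ℝ) x = x := by rw [homothety_eq_add_smul, one_smul, add_sub_cancel]
  simp only [e] at h
  nlinarith [h]

/-- **Radial quadratic upper bound from a second-derivative ceiling along the segment.**  If `g′(0) ≤ 0` (e.g. `= 0`: `x⋆` critical) and `g″ ≤ A‖x − x⋆‖²` on
`[0,1]` along `s ↦ F(homothety x⋆ s x)`, then `F x − F x⋆ ≤ (A/2)‖x − x⋆‖²`. [folklore] -/
theorem radialUpper_of_segment {E : Type*} [NormedAddCommGroup E] [NormedSpace ℝ E] {F : E → ℝ} {xs x : E} {g' g'' : ℝ → ℝ} {A : ℝ}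
    (hg : ∀ s, HasDerivAt (fun s : ℝ => F (AffineMap.homothety xs s x)) (g' s) s) (hg' : ∀ s, HasDerivAt g' (g'' s) s)
    (h0 : g' 0 ≤ 0) (hceil : ∀ s ∈ Icc (0 : ℝ) 1, g'' s ≤ A * ‖x - xs‖ ^ 2) :
    F x - F xs ≤ A / 2 * ‖x - xs‖ ^ 2 := by
  have h := sub_le_of_deriv2_le hg hg' hceil h0 (left_mem_Icc.2 zero_le_one)
  have e1 : AffineMap.homothety xs (1 : ℝ) x = x := by rw [homothety_eq_add_smul, one_smul, add_sub_cancel]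
  have e0 : AffineMap.homothety xs (0 : ℝ) x = xs := by rw [homothety_eq_add_smul, zero_smul, add_zero]
  simp only [e1, e0] at h
  nlinarith [h]

end Summit.HubbardSuperconductivity.HubbardSuperconductivity.Theorems.ThinLevelSet

end
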